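import Summits.BirchSwinnertonDyer.BirchSwinnertonDyer.Theorems.Rank2Observatory2DescRowCert
import Summits.BirchSwinnertonDyer.BirchSwinnertonDyer.Theorems.Rank2Observatory2DescRealSieve
import Literature.NumberTheory.EllipticCurves.BSDInvariantsProofs
import Mathlib.AlgebraicGeometry.EllipticCurve.VariableChange
import HarnessLib

/-!
# BirchSwinnertonDyer — rank ≥ 2 observatory: ROW CERTIFICATES over TOTALLY REAL cubic fields — data, `r`-checker, soundness (KERNEL-2DESC v2.0, rank-3 arm S5)

HONEST FRAMING: per-curve certified theorems and census instruments; no claim on BSD in rank ≥ 2.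

Generic addendum of the KERNEL-2DESC instrument (cert-3 design `b2b-bsdr2-cert-3/KERNEL-2DESC.md` §12 —
the RESHAPE of the per-curve certificate stream into sharded row files, gate4 CERT-LANE ruling
2026-08-22; cert-2 plan `code/b2b-bsdr2-cert-2/v2/RANK3-V2.md`, step S5). `Rank2Observatory2DescRowCert`
(+ `…RowCertSound`, `…RowCertLe`) handle a monogenic COMPLEX cubic 2-division field (one real place,
`disc F < 0`). This file is the same row format and kernel checker for a monogenic TOTALLY REAL cubic
field `K = ℚ(α)`: every generator carries THREE sign bits (one per real place `ρ₀, ρ₁, ρ₂` of the landed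
field file, each with its isolating interval of `ρₖ(α)`), the unit family carries three sign-bit vectors,
the row names the `θ`-ORDER of the places (`ord`: `ρ_{ord 0}(θ) < ρ_{ord 1}(θ) < ρ_{ord 2}(θ)`, certified by
interval arithmetic, `linLtCond` = the hypothesis of `lin_lt_lin`), and admissibility is the landed
three-real-place sieve `admStd3RQ` (`admStd3R_sound`: the place of the smallest conjugate of `θ` is
positive on the class, the two others have equal signs) minus the killed classes (`admKills`). The
assembly `rank_le_of_checkR r` is the v1.x totally-real per-curve template (`gen_percurve_r3r.py`:
`adm_sound`, `admQ_sound`, `mordellWeilRank_le_three`) done ONCE with variables and the count clause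
`card < 2^(r+1)` (`mordellWeilRank_le_of_coverSet_lt`); `rank_eq_of_checkR[_complSq]` add the tree lower
bound (and the completed-square model). Sorry-free; axioms `propext`, `Classical.choice`, `Quot.sound`.
[folklore] [cite: Cassels1991LecturesEllipticCurves, §15] [cite: CremonaAlgorithms1997, §3.6]
-/

-- single-conjunct summit: `Summit.BirchSwinnertonDyer.BirchSwinnertonDyer.…` repeats the name by design
set_option linter.dupNamespace false

open scoped NumberField

open Literature.NumberTheory.NumberFields Polynomial Module NumberField

namespace Summit.BirchSwinnertonDyer.BirchSwinnertonDyer.Rank2Observatory.TwoDescCubic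

/-! ## Row data (totally real field) -/

/-- One prime generator `g = c₀ + c₁α + c₂α²` of the support of `F′(θ)` over a totally real cubic field:
coordinates, norm `n = ±p^f`, the rational prime `p`, residue degree `f`, exponent `e` in `F′(θ)`, and the
sign bits at the three real places of the field file (`true` = negative). [folklore] -/
structure GenDataR where
  /-- coordinates on `1, α, α²` -/
  g : ℤ × ℤ × ℤ
  /-- the norm -/
  n : ℤ
  /-- the rational prime below -/
  p : ℕ
  /-- residue degree -/
  f : ℕ
  /-- exponent in `F′(θ)` -/
  e : ℕ
  /-- sign bits at the field places `ρ₀, ρ₁, ρ₂` (`true` = negative) -/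
  sg : Fin 3 → Bool

/-- The generator datum seen at one place `k` (the complex-field `GenData` with the `k`-th sign bit), so the
landed clause checker `GenData.check` and its soundness lemmas are reused verbatim. [folklore] -/
abbrev GenDataR.at (d : GenDataR) (k : Fin 3) : GenData := ⟨d.g, d.n, d.p, d.f, d.e, d.sg k⟩

/-- The per-generator check at the three places (norm form, `|n| = p^f` with residue certificate, and the
sign condition on each isolating interval `I k = (loₖ, hiₖ)`). [folklore] -/
def GenDataR.check (a b c : ℤ) (I : Fin 3 → ℚ × ℚ) (d : GenDataR) : Bool :=
  (List.finRange 3).all fun k => (d.at k).check a b c (I k).1 (I k).2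

/-- The 2-descent certificate of one curve over a totally real cubic field with `m` listed units: as
`CurveCert`, with three-place generator data and the `θ`-order `ord` of the places. [folklore] -/
structure CurveCertR (m : ℕ) where
  /-- `a₂` -/
  A : ℤ
  /-- `a₄` -/
  B : ℤ
  /-- `a₆` -/
  C : ℤ
  /-- a prime modulo which `F` has no root -/
  p0 : ℕ
  /-- coordinates of the root `θ` of `F` -/
  t : ℤ × ℤ × ℤ
  /-- the unit cofactor of `F′(θ)` -/
  u : ℤ × ℤ × ℤ
  /-- its inverse -/
  uinv : ℤ × ℤ × ℤ
  /-- the prime generators of the support of `F′(θ)` -/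
  gens : List GenDataR
  /-- square-residue moduli of the admissibility test -/
  Q : List ℕ
  /-- the killed classes -/
  kills : List KillRaw
  /-- `θ`-order of the places: `ρ_{ord 0}(θ) < ρ_{ord 1}(θ) < ρ_{ord 2}(θ)` -/
  ord : Fin 3 → Fin 3

section sound

variable {K : Type*} [Field K] [NumberField K] {a b c : ℤ} {α : K}

/-- Components of a checked three-place generator. [folklore] -/
theorem GenDataR.check_at {I : Fin 3 → ℚ × ℚ} {d : GenDataR} (h : d.check a b c I = true) (k : Fin 3) :
    (d.at k).check a b c (I k).1 (I k).2 = true := by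
  rw [GenDataR.check, List.all_eq_true] at h
  exact h k (List.mem_finRange k)

/-- **Norm of a checked generator.** [folklore] -/
theorem GenDataR.norm_of_check (hirr : Irreducible (MonicCubic.polyQ a b c))
    (hα : aeval α (MonicCubic.poly a b c) = 0) (h3 : finrank ℚ K = 3) {I : Fin 3 → ℚ × ℚ} {d : GenDataR}
    (h : d.check a b c I = true) :
    Algebra.norm ℚ ((lin hα d.g.1 d.g.2.1 d.g.2.2 : 𝓞 K) : K) = ((d.n : ℤ) : ℚ) := by
  have h' := GenData.norm_of_check hirr hα h3 (GenDataR.check_at h 0)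
  simpa only [GenDataR.at] using h'

/-- **A checked generator is a prime element** (given the primality of the rational prime below it).
[cite: Marcus2018, Ch. 3, Thm. 22] -/
theorem GenDataR.prime_of_check (hirr : Irreducible (MonicCubic.polyQ a b c))
    (hα : aeval α (MonicCubic.poly a b c) = 0) (h3 : finrank ℚ K = 3) {I : Fin 3 → ℚ × ℚ} {d : GenDataR}
    (h : d.check a b c I = true) (hp : d.p.Prime) :
    Prime (lin hα d.g.1 d.g.2.1 d.g.2.2 : 𝓞 K) :=
  GenData.prime_of_check hirr hα h3 (GenDataR.check_at h 0) hp

/-- **Sign of a checked generator at the place `k`.** [folklore] -/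
theorem GenDataR.sign_iff_of_check (hα : aeval α (MonicCubic.poly a b c) = 0) {I : Fin 3 → ℚ × ℚ}
    (k : Fin 3) (ρ : K →+* ℝ) (h0 : 0 ≤ (I k).1) (hlo : (((I k).1 : ℚ) : ℝ) < ρ α)
    (hhi : ρ α < (((I k).2 : ℚ) : ℝ)) {d : GenDataR} (h : d.check a b c I = true) :
    (d.sg k = true ↔ ρ ((lin hα d.g.1 d.g.2.1 d.g.2.2 : 𝓞 K) : K) < 0) :=
  GenData.sign_iff_of_check hα ρ h0 hlo hhi (GenDataR.check_at h k)

end sound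

/-! ## The whole-row checker -/

/-- The `θ`-order condition of `lin_lt_lin` between two places with isolating intervals `(lo, hi)`,
`(lo', hi')` of `α`, for `θ = t₀ + t₁α + t₂α²`, as a Bool. [folklore] -/
def linLtCond (lo hi lo' hi' : ℚ) (t : ℤ × ℤ × ℤ) : Bool :=
  decide ((t.1 : ℚ) + max ((t.2.1 : ℚ) * lo) ((t.2.1 : ℚ) * hi) + max ((t.2.2 : ℚ) * lo ^ 2) ((t.2.2 : ℚ) * hi ^ 2) <
    (t.1 : ℚ) + min ((t.2.1 : ℚ) * lo') ((t.2.1 : ℚ) * hi') + min ((t.2.2 : ℚ) * lo' ^ 2) ((t.2.2 : ℚ) * hi' ^ 2))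

/-- Generator coordinates of the row as a `Fin`-family. [folklore] -/
def CurveCertR.cg {m : ℕ} (cc : CurveCertR m) : Fin cc.gens.length → ℤ × ℤ × ℤ := fun j => (cc.gens.get j).g

/-- The killed classes of the row as `KillEntry`s. [folklore] -/
def CurveCertR.killEntries {m : ℕ} (a b c : ℤ) (ucoords : Fin m → ℤ × ℤ × ℤ) (cc : CurveCertR m) :
    List (KillEntry m cc.gens.length) :=
  cc.kills.map (KillRaw.toEntry a b c ucoords cc.cg)

/-- The sieve of the row: residue-square + three-real-place sign admissibility (places in `θ`-order),
minus the killed classes. [folklore] -/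
def CurveCertR.adm {m : ℕ} (a b c : ℤ) (ucoords : Fin m → ℤ × ℤ × ℤ) (Nu : Fin m → ℤ)
    (su : Fin 3 → Fin m → Bool) (cc : CurveCertR m) : Finset (Fin m) → Finset (Fin cc.gens.length) → Bool :=
  admKills (admStd3RQ cc.Q Nu (fun j => (cc.gens.get j).n) (su (cc.ord 0)) (su (cc.ord 1)) (su (cc.ord 2))
      (fun j => (cc.gens.get j).sg (cc.ord 0)) (fun j => (cc.gens.get j).sg (cc.ord 1))
      (fun j => (cc.gens.get j).sg (cc.ord 2)))
    (cc.killEntries a b c ucoords)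

/-- **The row checker over a totally real field, rank bound `r` as a parameter.** Field inputs: the field
cubic `(a, b, c)`, the isolating intervals `I k = (loₖ, hiₖ)` of `ρₖ(α)`, the unit family's coordinates / norms
/ sign bits per place. Clauses: elliptic; `F` has no root mod `p0`; `F(θ) = 0`; `F′(θ) = u·∏ gⱼ^eⱼ` and
`u·u⁻¹ = 1`; every generator checked at the three places; generator coordinates pairwise distinct; the
`θ`-order of the places (`linLtCond`, twice); residue moduli positive; the kill-list certificate; no killed
class trivial; fewer than `2^(r+1)` classes survive. [cite: Cassels1991LecturesEllipticCurves, §15]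
[cite: CremonaAlgorithms1997, §3.6] -/
def CurveCertR.checkR {m : ℕ} (r : ℕ) (a b c : ℤ) (I : Fin 3 → ℚ × ℚ) (ucoords : Fin m → ℤ × ℤ × ℤ)
    (Nu : Fin m → ℤ) (su : Fin 3 → Fin m → Bool) (cc : CurveCertR m) : Bool :=
  decide (deltaShort cc.A cc.B cc.C ≠ 0) &&
  noRootMod cc.p0 cc.A cc.B cc.C &&
  decide (cubicAtCoords a b c cc.A cc.B cc.C cc.t = (0, 0, 0)) &&
  decide (derivAtCoords a b c cc.A cc.B cc.t =
    MonicCubic.mulCoords a b c cc.u (prodPowCoords a b c (cc.gens.map fun d => (d.g, d.e)))) &&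
  decide (MonicCubic.mulCoords a b c cc.u cc.uinv = (1, 0, 0)) &&
  cc.gens.all (GenDataR.check a b c I) &&
  decide ((cc.gens.map GenDataR.g).Nodup) &&
  (linLtCond (I (cc.ord 0)).1 (I (cc.ord 0)).2 (I (cc.ord 1)).1 (I (cc.ord 1)).2 cc.t &&
    linLtCond (I (cc.ord 1)).1 (I (cc.ord 1)).2 (I (cc.ord 2)).1 (I (cc.ord 2)).2 cc.t) &&
  (cc.Q.all fun q => decide (0 < q)) &&
  killListCheck a b c cc.t.2.1 cc.t.2.2 ucoords cc.cg (cc.killEntries a b c ucoords) &&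
  ((cc.killEntries a b c ucoords).all fun e => !(decide (e.T = ∅) && decide (e.U = ∅))) &&
  decide (((Finset.univ ×ˢ Finset.univ).filter
      (fun TU : Finset (Fin m) × Finset (Fin cc.gens.length) =>
        cc.adm a b c ucoords Nu su TU.1 TU.2 = true)).card < 2 ^ (r + 1))

section assembly

variable {K : Type*} [Field K] [NumberField K] {a b c : ℤ} {α : K}

/-- **Soundness of the totally-real row checker: `rank E(ℚ) ≤ r`.** [cite: Cassels1991LecturesEllipticCurves, §15] -/
theorem rank_le_of_checkR (r : ℕ) [IsPrincipalIdealRing (𝓞 K)]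
    (hirr : Irreducible (MonicCubic.polyQ a b c)) (hα : aeval α (MonicCubic.poly a b c) = 0)
    (h3 : finrank ℚ K = 3) {m : ℕ} (Wu : Fin m → (𝓞 K)ˣ)
    (hW : ∀ u : (𝓞 K)ˣ, ∃ T : Finset (Fin m), IsSquare (u * ∏ i ∈ T, Wu i))
    (ucoords : Fin m → ℤ × ℤ × ℤ)
    (hWu : ∀ i, ((Wu i : (𝓞 K)ˣ) : 𝓞 K) = lin hα (ucoords i).1 (ucoords i).2.1 (ucoords i).2.2)
    {Nu : Fin m → ℤ} (hNu : ∀ i, Algebra.norm ℚ (((Wu i : (𝓞 K)ˣ) : 𝓞 K) : K) = Nu i)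
    (ρ : Fin 3 → (K →+* ℝ)) {I : Fin 3 → ℚ × ℚ} (h0 : ∀ k, 0 ≤ (I k).1)
    (hlo : ∀ k, (((I k).1 : ℚ) : ℝ) < ρ k α) (hhi : ∀ k, ρ k α < (((I k).2 : ℚ) : ℝ))
    {su : Fin 3 → Fin m → Bool} (hsu : ∀ k i, (su k i = true ↔ ρ k (((Wu i : (𝓞 K)ˣ) : 𝓞 K) : K) < 0))
    (cc : CurveCertR m) (hc : cc.checkR r a b c I ucoords Nu su = true)
    (hprimes : (cc.gens.map GenDataR.p).Forall Nat.Prime) :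
    ((⟨0, cc.A, 0, cc.B, cc.C⟩ : WeierstrassCurve ℚ)).mordellWeilRank ≤ r := by
  classical
  have hprimes' : ∀ d ∈ cc.gens, d.p.Prime := fun d hd =>
    (List.forall_iff_forall_mem.mp hprimes) _ (List.mem_map.mpr ⟨d, hd, rfl⟩)
  simp only [CurveCertR.checkR, Bool.and_eq_true, decide_eq_true_eq, List.all_eq_true] at hc
  obtain ⟨⟨⟨⟨⟨⟨⟨⟨⟨⟨⟨hΔ, hirrF⟩, hθ⟩, hder⟩, huinv⟩, hgens⟩, hnodup⟩, hord⟩, hQ⟩, hkill⟩, hTU⟩, hcount⟩ := hc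
  haveI hE := isElliptic_of_deltaShort_ne hΔ
  have hirrF' := irreducible_of_noRootMod hirrF
  have haev := aeval_lin_eq_zero_of_coords hα cc.t hθ
  -- the generators
  set s := cc.gens.length with hs
  set G : Fin s → 𝓞 K := fun j => lin hα (cc.gens.get j).g.1 (cc.gens.get j).g.2.1 (cc.gens.get j).g.2.2
    with hG
  have hGchk : ∀ j : Fin s, (cc.gens.get j).check a b c I = true := fun j => hgens _ (List.get_mem _ _)
  have hGp : ∀ j, Prime (G j) := fun j =>
    GenDataR.prime_of_check hirr hα h3 (hGchk j) (hprimes' _ (List.get_mem _ _))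
  have hGi : Function.Injective G := by
    intro i j hij
    by_contra hne
    have hgne : (cc.gens.get i).g ≠ (cc.gens.get j).g := by
      intro hg
      apply hne
      have hinj := List.inj_on_of_nodup_map hnodup
      have heq : cc.gens.get i = cc.gens.get j := hinj (List.get_mem _ _) (List.get_mem _ _) hg
      exact (List.Nodup.get_inj_iff (List.Nodup.of_map _ hnodup)).mp heq
    have hne3 : (cc.gens.get i).g.1 ≠ (cc.gens.get j).g.1 ∨ (cc.gens.get i).g.2.1 ≠ (cc.gens.get j).g.2.1 ∨
        (cc.gens.get i).g.2.2 ≠ (cc.gens.get j).g.2.2 := by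
      by_contra hcon
      simp only [ne_eq, not_or, not_not] at hcon
      exact hgne (Prod.ext hcon.1 (Prod.ext hcon.2.1 hcon.2.2))
    exact lin_ne hirr hα h3 hne3 hij
  -- the support of F′(θ)
  have hu : IsUnit (lin hα cc.u.1 cc.u.2.1 cc.u.2.2) := isUnit_lin_of_coords hα cc.u cc.uinv huinv
  have hder' := deriv_eq_of_coords hα cc.t cc.u (cc.gens.map fun d => (d.g, d.e)) hder
  have hD : ∀ q : 𝓞 K, Prime q →
      q ∣ 3 * (lin hα cc.t.1 cc.t.2.1 cc.t.2.2) ^ 2 + 2 * (cc.A : 𝓞 K) * (lin hα cc.t.1 cc.t.2.1 cc.t.2.2) + (cc.B : 𝓞 K) →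
      ∃ j, Associated q (G j) := by
    intro q hq hdvd
    have hdvd' : q ∣ lin hα cc.u.1 cc.u.2.1 cc.u.2.2 *
        ((cc.gens.map fun d => (d.g, d.e)).map fun ge => (lin hα ge.1.1 ge.1.2.1 ge.1.2.2) ^ ge.2).prod := by
      have e : (3 : 𝓞 K) * (lin hα cc.t.1 cc.t.2.1 cc.t.2.2) ^ 2 + 2 * ((cc.A : ℤ) : 𝓞 K) * (lin hα cc.t.1 cc.t.2.1 cc.t.2.2) +
          ((cc.B : ℤ) : 𝓞 K) = _ := hder'
      rw [← e]
      simpa using hdvd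
    rcases hq.dvd_or_dvd hdvd' with h1 | h1
    · exact absurd (isUnit_of_dvd_unit h1 hu) hq.not_unit
    rw [List.map_map] at h1
    obtain ⟨x, hx, hqx⟩ := (Prime.dvd_prod_iff hq).mp h1
    rw [List.mem_map] at hx
    obtain ⟨d, hd, rfl⟩ := hx
    obtain ⟨j, hj⟩ := List.mem_iff_get.mp hd
    refine ⟨j, ?_⟩
    have hqd : q ∣ lin hα d.g.1 d.g.2.1 d.g.2.2 := hq.dvd_of_dvd_pow hqx
    have hGj : G j = lin hα d.g.1 d.g.2.1 d.g.2.2 := by simp only [hG, hj]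
    rw [hGj]
    exact hq.associated_of_dvd (hj ▸ hGp j) hqd
  -- the θ-order of the three places
  simp only [linLtCond, decide_eq_true_eq] at hord
  have h12 : ρ (cc.ord 0) (algebraMap (𝓞 K) K (lin hα cc.t.1 cc.t.2.1 cc.t.2.2)) <
      ρ (cc.ord 1) (algebraMap (𝓞 K) K (lin hα cc.t.1 cc.t.2.1 cc.t.2.2)) :=
    lin_lt_lin hα (ρ (cc.ord 0)) (ρ (cc.ord 1)) (h0 _) (hlo _) (hhi _) (h0 _) (hlo _) (hhi _)
      cc.t.1 cc.t.2.1 cc.t.2.2 hord.1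
  have h23 : ρ (cc.ord 1) (algebraMap (𝓞 K) K (lin hα cc.t.1 cc.t.2.1 cc.t.2.2)) <
      ρ (cc.ord 2) (algebraMap (𝓞 K) K (lin hα cc.t.1 cc.t.2.1 cc.t.2.2)) :=
    lin_lt_lin hα (ρ (cc.ord 1)) (ρ (cc.ord 2)) (h0 _) (hlo _) (hhi _) (h0 _) (hlo _) (hhi _)
      cc.t.1 cc.t.2.1 cc.t.2.2 hord.2
  -- admissibility
  have hQpos : ∀ q ∈ cc.Q, 0 < q := fun q hq' => hQ q hq'
  have hadm : ∀ x y : ℚ, y ^ 2 = x ^ 3 + cc.A * x ^ 2 + cc.B * x + cc.C →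
      ∀ (T : Finset (Fin m)) (U : Finset (Fin s)),
        IsSquare ((algebraMap ℚ K x - algebraMap (𝓞 K) K (lin hα cc.t.1 cc.t.2.1 cc.t.2.2)) *
          (∏ i ∈ T, algebraMap (𝓞 K) K (Wu i)) * ∏ j ∈ U, algebraMap (𝓞 K) K (G j)) →
        cc.adm a b c ucoords Nu su T U = true := by
    intro x y hxy T U hsq
    have hstd := admStd3R_sound hirrF' haev h3 (ρ (cc.ord 0)) (ρ (cc.ord 1)) (ρ (cc.ord 2)) h12 h23
      (w := fun i => algebraMap (𝓞 K) K (Wu i)) (g := fun j => algebraMap (𝓞 K) K (G j))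
      (fun i => (RingOfIntegers.coe_ne_zero_iff).mpr (Units.ne_zero _))
      (fun j => (RingOfIntegers.coe_ne_zero_iff).mpr (hGp j).ne_zero)
      (Nu := Nu) (fun i => hNu i)
      (Ng := fun j => (cc.gens.get j).n) (fun j => GenDataR.norm_of_check hirr hα h3 (hGchk j))
      (su₁ := su (cc.ord 0)) (su₂ := su (cc.ord 1)) (su₃ := su (cc.ord 2))
      (sg₁ := fun j => (cc.gens.get j).sg (cc.ord 0)) (sg₂ := fun j => (cc.gens.get j).sg (cc.ord 1))
      (sg₃ := fun j => (cc.gens.get j).sg (cc.ord 2))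
      (hsu _) (hsu _) (hsu _)
      (fun j => GenDataR.sign_iff_of_check hα (cc.ord 0) (ρ _) (h0 _) (hlo _) (hhi _) (hGchk j))
      (fun j => GenDataR.sign_iff_of_check hα (cc.ord 1) (ρ _) (h0 _) (hlo _) (hhi _) (hGchk j))
      (fun j => GenDataR.sign_iff_of_check hα (cc.ord 2) (ρ _) (h0 _) (hlo _) (hhi _) (hGchk j))
      x y hxy T U hsq
    have hstdQ := admStd3RQ_of_admStd3R (Q := cc.Q) hQpos hstd
    exact admKills_sound hirr hα h3 cc.t.1 (fun i => ((Wu i : (𝓞 K)ˣ) : 𝓞 K)) G hWu (fun j => rfl) hkill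
      hstdQ x hsq
  -- the count
  exact mordellWeilRank_le_of_coverSet_lt (A := cc.A) (B := cc.B) (C := cc.C)
    (⟨0, cc.A, 0, cc.B, cc.C⟩ : WeierstrassCurve ℚ) rfl rfl rfl rfl rfl hirrF' haev h3 hGi
    (fun j => (hGp j).ne_zero) hD hW
    (adm := cc.adm a b c ucoords Nu su)
    (admKills_empty (admStd3RQ_empty cc.Q hQpos _ _ _ _ _ _ _ _) (List.all_eq_true.mpr hTU)) hadm hcount

/-- **`rank E(ℚ) = r` from an `r`-checked totally-real row and the tree's lower bound `r ≤ rank`.**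
[cite: CremonaAlgorithms1997, §3.6] -/
theorem rank_eq_of_checkR (r : ℕ) [IsPrincipalIdealRing (𝓞 K)]
    (hirr : Irreducible (MonicCubic.polyQ a b c)) (hα : aeval α (MonicCubic.poly a b c) = 0)
    (h3 : finrank ℚ K = 3) {m : ℕ} (Wu : Fin m → (𝓞 K)ˣ)
    (hW : ∀ u : (𝓞 K)ˣ, ∃ T : Finset (Fin m), IsSquare (u * ∏ i ∈ T, Wu i))
    (ucoords : Fin m → ℤ × ℤ × ℤ)
    (hWu : ∀ i, ((Wu i : (𝓞 K)ˣ) : 𝓞 K) = lin hα (ucoords i).1 (ucoords i).2.1 (ucoords i).2.2)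
    {Nu : Fin m → ℤ} (hNu : ∀ i, Algebra.norm ℚ (((Wu i : (𝓞 K)ˣ) : 𝓞 K) : K) = Nu i)
    (ρ : Fin 3 → (K →+* ℝ)) {I : Fin 3 → ℚ × ℚ} (h0 : ∀ k, 0 ≤ (I k).1)
    (hlo : ∀ k, (((I k).1 : ℚ) : ℝ) < ρ k α) (hhi : ∀ k, ρ k α < (((I k).2 : ℚ) : ℝ))
    {su : Fin 3 → Fin m → Bool} (hsu : ∀ k i, (su k i = true ↔ ρ k (((Wu i : (𝓞 K)ˣ) : 𝓞 K) : K) < 0))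
    (cc : CurveCertR m) (hc : cc.checkR r a b c I ucoords Nu su = true)
    (hprimes : (cc.gens.map GenDataR.p).Forall Nat.Prime)
    (hlow : r ≤ (((⟨0, cc.A, 0, cc.B, cc.C⟩ : WeierstrassCurve ℤ)).map (Int.castRingHom ℚ)).mordellWeilRank) :
    (((⟨0, cc.A, 0, cc.B, cc.C⟩ : WeierstrassCurve ℤ)).map (Int.castRingHom ℚ)).mordellWeilRank = r := by
  have hE : ((⟨0, cc.A, 0, cc.B, cc.C⟩ : WeierstrassCurve ℤ)).map (Int.castRingHom ℚ) =
      (⟨0, cc.A, 0, cc.B, cc.C⟩ : WeierstrassCurve ℚ) := by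
    ext <;> simp [WeierstrassCurve.map]
  refine le_antisymm ?_ hlow
  rw [hE]
  exact rank_le_of_checkR r hirr hα h3 Wu hW ucoords hWu hNu ρ h0 hlo hhi hsu cc hc hprimes

/-- **`rank E(ℚ) = r` for the ORIGINAL model** `(a₁, a₂, a₃, a₄, a₆)` when the totally-real row certifies its
completed-square model `(0, a₁² + 4a₂, 0, 8(a₁a₃ + 2a₄), 16(a₃² + 4a₆))` (rank is invariant under the variable
change, `mordellWeilRank_variableChange`). [cite: CremonaAlgorithms1997, §3.6] -/
theorem rank_eq_of_checkR_complSq (r : ℕ) [IsPrincipalIdealRing (𝓞 K)]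
    (hirr : Irreducible (MonicCubic.polyQ a b c)) (hα : aeval α (MonicCubic.poly a b c) = 0)
    (h3 : finrank ℚ K = 3) {m : ℕ} (Wu : Fin m → (𝓞 K)ˣ)
    (hW : ∀ u : (𝓞 K)ˣ, ∃ T : Finset (Fin m), IsSquare (u * ∏ i ∈ T, Wu i))
    (ucoords : Fin m → ℤ × ℤ × ℤ)
    (hWu : ∀ i, ((Wu i : (𝓞 K)ˣ) : 𝓞 K) = lin hα (ucoords i).1 (ucoords i).2.1 (ucoords i).2.2)
    {Nu : Fin m → ℤ} (hNu : ∀ i, Algebra.norm ℚ (((Wu i : (𝓞 K)ˣ) : 𝓞 K) : K) = Nu i)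
    (ρ : Fin 3 → (K →+* ℝ)) {I : Fin 3 → ℚ × ℚ} (h0 : ∀ k, 0 ≤ (I k).1)
    (hlo : ∀ k, (((I k).1 : ℚ) : ℝ) < ρ k α) (hhi : ∀ k, ρ k α < (((I k).2 : ℚ) : ℝ))
    {su : Fin 3 → Fin m → Bool} (hsu : ∀ k i, (su k i = true ↔ ρ k (((Wu i : (𝓞 K)ˣ) : 𝓞 K) : K) < 0))
    (cc : CurveCertR m) (hc : cc.checkR r a b c I ucoords Nu su = true)
    (hprimes : (cc.gens.map GenDataR.p).Forall Nat.Prime) (a₁ a₂ a₃ a₄ a₆ : ℤ)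
    (hABC : cc.A = a₁ ^ 2 + 4 * a₂ ∧ cc.B = 8 * (a₁ * a₃ + 2 * a₄) ∧ cc.C = 16 * (a₃ ^ 2 + 4 * a₆))
    (hlow : r ≤ (((⟨a₁, a₂, a₃, a₄, a₆⟩ : WeierstrassCurve ℤ)).map (Int.castRingHom ℚ)).mordellWeilRank) :
    (((⟨a₁, a₂, a₃, a₄, a₆⟩ : WeierstrassCurve ℤ)).map (Int.castRingHom ℚ)).mordellWeilRank = r := by
  obtain ⟨hA, hB, hC⟩ := hABC
  have hE : ((⟨0, cc.A, 0, cc.B, cc.C⟩ : WeierstrassCurve ℤ)).map (Int.castRingHom ℚ) =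
      (⟨0, cc.A, 0, cc.B, cc.C⟩ : WeierstrassCurve ℚ) := by
    ext <;> simp [WeierstrassCurve.map]
  have hV : ((⟨0, cc.A, 0, cc.B, cc.C⟩ : WeierstrassCurve ℤ)).map (Int.castRingHom ℚ) =
      (⟨Units.mk0 (1 / 2 : ℚ) (by norm_num), 0, -(a₁ : ℚ) / 2, -(a₃ : ℚ) / 2⟩ :
        WeierstrassCurve.VariableChange ℚ) •
        (((⟨a₁, a₂, a₃, a₄, a₆⟩ : WeierstrassCurve ℤ)).map (Int.castRingHom ℚ)) := by
    ext <;> simp only [WeierstrassCurve.map_a₁, WeierstrassCurve.map_a₂, WeierstrassCurve.map_a₃,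
      WeierstrassCurve.map_a₄, WeierstrassCurve.map_a₆, WeierstrassCurve.variableChange_a₁,
      WeierstrassCurve.variableChange_a₂, WeierstrassCurve.variableChange_a₃,
      WeierstrassCurve.variableChange_a₄, WeierstrassCurve.variableChange_a₆, Units.val_inv_eq_inv_val,
      Units.val_mk0, hA, hB, hC, eq_intCast, Int.cast_zero] <;> push_cast <;> ring
  have hr : (((⟨0, cc.A, 0, cc.B, cc.C⟩ : WeierstrassCurve ℤ)).map (Int.castRingHom ℚ)).mordellWeilRank =
      (((⟨a₁, a₂, a₃, a₄, a₆⟩ : WeierstrassCurve ℤ)).map (Int.castRingHom ℚ)).mordellWeilRank := by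
    rw [hV]; exact WeierstrassCurve.mordellWeilRank_variableChange_holds _ _
  rw [← hr] at hlow ⊢
  refine le_antisymm ?_ hlow
  rw [hE]
  exact rank_le_of_checkR r hirr hα h3 Wu hW ucoords hWu hNu ρ h0 hlo hhi hsu cc hc hprimes

end assembly


/-- Kernel sanity check on real data: the row of `161135f1` (completed-square model `y² = x³ − 53728x + 3724048`;
totally real field `148`, `x³ − 7x² + 13x − 5`, unit family `(-1, fu₁, fu₂)` and place data as in the field file
`Rank2ObservatoryCubicFieldR148`; `16` admissible classes, the class of generators `{4, 5}` killed at `p = 2`, `15 < 2⁴`). -/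
example : CurveCertR.checkR 3 (-7) 13 (-5) ![((103761/200000 : ℚ), (259403/500000 : ℚ)), ((2311107/1000000 : ℚ), (577777/250000 : ℚ)), ((2085043/500000 : ℚ), (4170087/1000000 : ℚ))]
      ![((-1), 0, 0), (2, (-1), 0), (2, (-4), 1)] ![(-1), 1, (-1)]
      ![![true, false, false], ![true, true, true], ![true, true, false]]
    ⟨0, (-53728), 3724048, 3, (172, 38, (-34)), (2157, (-5091), 1799), ((-242), 425, (-88)),
      [⟨(4, (-5), 1), (-2), 2, 1, 8, ![false, true, false]⟩, ⟨(6, (-9), 2), (-25), 5, 2, 1, ![false, true, false]⟩, ⟨(8, (-8), 1), 169, 13, 2, 1, ![false, true, true]⟩, ⟨((-6), 1, 0), (-37), 37, 1, 3, ![true, true, true]⟩, ⟨(7, (-7), 1), 67, 67, 1, 1, ![false, true, true]⟩, ⟨(13, (-12), 2), 67, 67, 1, 1, ![false, true, true]⟩],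
      [4, 8], [⟨[], [4, 5], 2, 1⟩], ![2, 1, 0]⟩ = true := by
  decide +kernel

end Summit.BirchSwinnertonDyer.BirchSwinnertonDyer.Rank2Observatory.TwoDescCubic
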